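import Literature.AlgebraicGeometry.Resolution.LogRegularSchemeEtale
import Mathlib.AlgebraicGeometry.Noetherian
import HarnessLib

/-!
# Affine étale pieces of a log regular étale fs log scheme: a finite jointly surjective family of
# affine opens of the chart domains, on which the charts satisfy Kato's (2.1) at every prime
# (Nizioł 2006, §2.1 / Def. 2.2; Kato 1994, Def. (2.1))

Topic: `Literature/AlgebraicGeometry/Resolution`. Block EK-0 «AFFINE PIECES» of the ÉTALE KATO programme of cell
res-hironaka (res-type-037, `ETALE-KATO-SPEC.md` v1), towards the named fact
`Niziol2006_logRegularScheme_hasResolution` (`LogRegularSchemeEtale.lean`). An étale fs log structure is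
presented by an `EtaleLogAtlas 𝒜`: finitely many ÉTALE `X`-schemes `𝒜.map i : 𝒜.U i ⟶ X` with charts
`𝒜.chart i : P i → Γ(U i, 𝒪)`; `𝒜.IsLogRegular` asks Kato's (2.1) (`LogChart.IsLogRegularLocal`) for the chart
through every local ring `𝒪_{U i, u}`. The resolution is built chartwise on AFFINE schemes carrying ONE global
chart which is log regular at every PRIME (the setting of `LogChart.IsLogRegularAt`,
`Kato1994_logRegular_hasResolution`, `LogAtlas.ofAffineChart`); this file PROVES that a log regular étale
atlas on a quasi-compact `X` is covered by finitely many such pieces: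

* `EtaleLogAtlas.isLogRegularLocal_stalkChart_iff_isLogRegularAt` — on an affine open `V ⊆ U i`, Kato's condition
  for the stalk chart at `u ∈ V` is `LogChart.IsLogRegularAt` for the chart restricted to `Γ(U i, V)` at the prime
  of `u` (`𝒪_{U i,u} ≅ Γ(U i, V)_𝔭`; the étale-atlas twin of `LogAtlas.isLogRegularLocal_stalkChart_iff`);
* `EtaleLogAtlas.IsLogRegular.isLocallyNoetherian_U`, `…isNoetherianRing_of_isAffineOpen` — the chart domains
  are locally Noetherian (étale over the locally Noetherian `X`);
* **`EtaleLogAtlas.IsLogRegular.isLogRegularAt_of_isAffineOpen`** — for `𝒜` log regular and `V ⊆ U i` affine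
  open, the restricted chart `P i → Γ(U i, V)` is log regular AT EVERY PRIME of `Γ(U i, V)`;
* **`EtaleLogAtlas.exists_finset_affineOpens_cover`** — for `X` quasi-compact there is a FINITE set of pairs
  `(i, V)`, `V` an affine open of `U i`, whose images `𝒜.map i (V)` cover `X` (étale maps are open; compactness);
  with `IsLogRegular.exists_affine_pieces` packaging both for the assembler: the pieces `V ↪ U i → X` are
  étale over `X` (`etale_ι_comp_map`), affine, jointly surjective, Noetherian, and log regular at every prime.

No definitions and no named facts are introduced. AI-written; AI review is weaker than expert review.

## Sources

* W. Nizioł, *Toric singularities: log-blow-ups and global resolutions*, J. Algebraic Geom. 15 (2006), §2.1,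
  Def. 2.2, Lemma 2.3. [Niziol2006]
* K. Kato, *Toric singularities*, Amer. J. Math. 116 (1994), Def. (2.1), (10.1)–(10.4). [Kato1994]
-/

noncomputable section

open AlgebraicGeometry CategoryTheory TopologicalSpace Opposite

namespace Literature.AlgebraicGeometry.Resolution

namespace EtaleLogAtlas

universe w u

variable {X : Scheme.{u}} (𝒜 : EtaleLogAtlas.{w} X)

/-! ## The stalk condition on an affine open of a chart domain -/

/-- **On an affine open `V ⊆ U i`, Kato's condition at `u ∈ V` for the stalk chart `φ_{i,u}` is
`LogChart.IsLogRegularAt` for the ring `Γ(U i, V)`, the restricted chart `P i → Γ(U i, ⊤) → Γ(U i, V)` and the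
prime of `u`** (`𝒪_{U i, u} ≅ Γ(U i, V)_𝔭`; étale-atlas twin of `LogAtlas.isLogRegularLocal_stalkChart_iff`).
[cite: Kato1994, Def. (2.1)] [cite: Niziol2006, Def. 2.2, Lemma 2.3] -/
theorem isLogRegularLocal_stalkChart_iff_isLogRegularAt (i : 𝒜.ι) {V : (𝒜.U i).Opens}
    (hV : IsAffineOpen V) (u : 𝒜.U i) (hu : u ∈ V) :
    LogChart.IsLogRegularLocal (𝒜.P i) (𝒜.stalkChart i u) ↔
      LogChart.IsLogRegularAt (𝒜.P i)
        (((𝒜.U i).presheaf.map (homOfLE (le_top : V ≤ ⊤)).op).hom.toMonoidHom.comp (𝒜.chart i))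
        (hV.primeIdealOf ⟨u, hu⟩).asIdeal := by
  letI alg : Algebra Γ(𝒜.U i, V) ((𝒜.U i).presheaf.stalk u) := ((𝒜.U i).presheaf.germ V u hu).hom.toAlgebra
  haveI : IsLocalization.AtPrime ((𝒜.U i).presheaf.stalk u) (hV.primeIdealOf ⟨u, hu⟩).asIdeal :=
    hV.isLocalization_stalk ⟨u, hu⟩
  let e : Localization.AtPrime (hV.primeIdealOf ⟨u, hu⟩).asIdeal ≃ₐ[Γ(𝒜.U i, V)]
      ((𝒜.U i).presheaf.stalk u : Type u) :=
    IsLocalization.algEquiv (hV.primeIdealOf ⟨u, hu⟩).asIdeal.primeCompl _ _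
  rw [LogChart.isLogRegularAt_iff_isLogRegularLocal,
    ← LogChart.isLogRegularLocal_comp_equiv _ _ e.toRingEquiv]
  have hcharts : e.toRingEquiv.toMonoidHom.comp
      ((algebraMap Γ(𝒜.U i, V)
          (Localization.AtPrime (hV.primeIdealOf ⟨u, hu⟩).asIdeal)).toMonoidHom.comp
        (((𝒜.U i).presheaf.map (homOfLE (le_top : V ≤ ⊤)).op).hom.toMonoidHom.comp (𝒜.chart i))) =
      𝒜.stalkChart i u := by
    refine MonoidHom.ext fun p => ?_
    change e (algebraMap Γ(𝒜.U i, V) _ (((𝒜.U i).presheaf.map (homOfLE (le_top : V ≤ ⊤)).op).hom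
      (𝒜.chart i p))) = ((𝒜.U i).presheaf.germ ⊤ u trivial).hom (𝒜.chart i p)
    rw [AlgEquiv.commutes, RingHom.algebraMap_toAlgebra]
    exact TopCat.Presheaf.germ_res_apply (𝒜.U i).presheaf (homOfLE (le_top : V ≤ ⊤)) u hu _
  rw [hcharts]

/-! ## The chart domains are locally Noetherian -/

/-- The chart domains of a log regular étale atlas are locally Noetherian (étale, hence locally of finite
type, over the locally Noetherian `X`). [cite: Niziol2006, Def. 2.2] -/
theorem IsLogRegular.isLocallyNoetherian_U {𝒜 : EtaleLogAtlas.{w} X} (h : 𝒜.IsLogRegular) (i : 𝒜.ι) :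
    IsLocallyNoetherian (𝒜.U i) := by
  haveI := h.isLocallyNoetherian
  exact LocallyOfFiniteType.isLocallyNoetherian (𝒜.map i)

/-- The sections over an affine open of a chart domain form a Noetherian ring. [cite: Niziol2006, Def. 2.2] -/
theorem IsLogRegular.isNoetherianRing_of_isAffineOpen {𝒜 : EtaleLogAtlas.{w} X} (h : 𝒜.IsLogRegular)
    (i : 𝒜.ι) {V : (𝒜.U i).Opens} (hV : IsAffineOpen V) : IsNoetherianRing Γ(𝒜.U i, V) := by
  haveI := h.isLocallyNoetherian_U i
  exact IsLocallyNoetherian.component_noetherian ⟨V, hV⟩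

/-! ## Log regularity at every prime of an affine piece -/

/-- Every prime of `Γ(U i, V)`, `V` affine, is the prime of a point of `V` (`IsAffineOpen.isoSpec`). [folklore] -/
private theorem exists_primeIdealOf_eq {Y : Scheme.{u}} {V : Y.Opens} (hV : IsAffineOpen V)
    (𝔭 : PrimeSpectrum Γ(Y, V)) : ∃ v : V, hV.primeIdealOf v = 𝔭 :=
  ⟨hV.isoSpec.inv 𝔭, by
    change (hV.isoSpec.inv ≫ hV.isoSpec.hom) 𝔭 = 𝔭
    rw [Iso.inv_hom_id]; rfl⟩

/-- **The restricted chart on an affine open of a chart domain is log regular at every prime**: for `𝒜` log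
regular and `V ⊆ U i` affine open, `LogChart.IsLogRegularAt (P i) (P i → Γ(U i, V)) 𝔭` for every prime `𝔭`
of `Γ(U i, V)` (every prime is the prime of a point `u ∈ V`, where the condition is the stalk condition).
[cite: Niziol2006, Def. 2.2, Lemma 2.3] [cite: Kato1994, Def. (2.1)] -/
theorem IsLogRegular.isLogRegularAt_of_isAffineOpen {𝒜 : EtaleLogAtlas.{w} X} (h : 𝒜.IsLogRegular)
    (i : 𝒜.ι) {V : (𝒜.U i).Opens} (hV : IsAffineOpen V) (𝔭 : PrimeSpectrum Γ(𝒜.U i, V)) :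
    LogChart.IsLogRegularAt (𝒜.P i)
      (((𝒜.U i).presheaf.map (homOfLE (le_top : V ≤ ⊤)).op).hom.toMonoidHom.comp (𝒜.chart i))
      𝔭.asIdeal := by
  obtain ⟨⟨u, hu⟩, rfl⟩ := exists_primeIdealOf_eq hV 𝔭
  exact (𝒜.isLogRegularLocal_stalkChart_iff_isLogRegularAt i hV u hu).mp (h.isLogRegularLocal i u)

/-! ## A finite jointly surjective family of affine pieces -/

/-- The composite `V ↪ U i → X` of the inclusion of an open of a chart domain with the (étale) structure map is
étale. [cite: Niziol2006, §2.1] -/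
theorem etale_ι_comp_map (i : 𝒜.ι) (V : (𝒜.U i).Opens) : Etale (V.ι ≫ 𝒜.map i) :=
  inferInstance

/-- **Finitely many affine pieces cover**: for `X` quasi-compact there is a finite set of pairs `(i, V)`, `V` an affine
open of the chart domain `U i`, such that every point of `X` is the image of a point of some `V` (the chart domains
cover `X`, affine opens form bases, étale maps are open, `X` is compact). [cite: Niziol2006, §2.1] -/
theorem exists_finset_affineOpens_cover [CompactSpace X] :
    ∃ t : Finset (Σ i : 𝒜.ι, (𝒜.U i).affineOpens),
      ∀ x : X, ∃ s ∈ t, ∃ u : 𝒜.U s.1, u ∈ (s.2 : (𝒜.U s.1).Opens) ∧ 𝒜.map s.1 u = x := by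
  classical
  let O : (Σ i : 𝒜.ι, (𝒜.U i).affineOpens) → Set X := fun s => 𝒜.map s.1 '' (s.2 : Set (𝒜.U s.1))
  have hO : ∀ s, IsOpen (O s) := fun s => (𝒜.map s.1).isOpenMap _ (s.2 : (𝒜.U s.1).Opens).2
  have hcov : (Set.univ : Set X) ⊆ ⋃ s, O s := by
    intro x _
    obtain ⟨i, u, rfl⟩ := 𝒜.exists_eq x
    obtain ⟨W, hW, huW, -⟩ := exists_isAffineOpen_mem_and_subset (Opens.mem_top u : u ∈ (⊤ : (𝒜.U i).Opens))
    exact Set.mem_iUnion.mpr ⟨⟨i, ⟨W, hW⟩⟩, u, huW, rfl⟩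
  obtain ⟨t, ht⟩ := isCompact_univ.elim_finite_subcover O hO hcov
  refine ⟨t, fun x => ?_⟩
  obtain ⟨s, hs, u, hu, hux⟩ : ∃ s ∈ t, ∃ u, u ∈ (s.2 : Set (𝒜.U s.1)) ∧ 𝒜.map s.1 u = x := by
    simpa only [Set.mem_iUnion, Set.mem_image, exists_prop, O] using ht (Set.mem_univ x)
  exact ⟨s, hs, u, hu, hux⟩

/-- **The affine étale pieces of a log regular étale fs log scheme** (block EK-0): for `X` quasi-compact and `𝒜` log
regular there are finitely many pairs `(i, V)`, `V ⊆ U i` affine open — so that `V ↪ U i → X` is étale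
(`etale_ι_comp_map`) from an affine scheme — jointly surjective onto `X`, with `Γ(U i, V)` Noetherian and the
restricted chart `P i → Γ(U i, V)` log regular at EVERY prime (the hypotheses of `Kato1994_logRegular_hasResolution`
/ `LogAtlas.isLogRegular_ofAffineChart_iff` on each piece). [cite: Niziol2006, §2.1, Def. 2.2, Lemma 2.3]
[cite: Kato1994, Def. (2.1)] -/
theorem IsLogRegular.exists_affine_pieces [CompactSpace X] {𝒜 : EtaleLogAtlas.{w} X} (h : 𝒜.IsLogRegular) :
    ∃ t : Finset (Σ i : 𝒜.ι, (𝒜.U i).affineOpens),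
      (∀ x : X, ∃ s ∈ t, ∃ u : 𝒜.U s.1, u ∈ (s.2 : (𝒜.U s.1).Opens) ∧ 𝒜.map s.1 u = x) ∧
      ∀ s ∈ t, IsNoetherianRing Γ(𝒜.U s.1, (s.2 : (𝒜.U s.1).Opens)) ∧
        ∀ 𝔭 : PrimeSpectrum Γ(𝒜.U s.1, (s.2 : (𝒜.U s.1).Opens)),
          LogChart.IsLogRegularAt (𝒜.P s.1)
            (((𝒜.U s.1).presheaf.map (homOfLE (le_top : (s.2 : (𝒜.U s.1).Opens) ≤ ⊤)).op).hom.toMonoidHom.comp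
              (𝒜.chart s.1)) 𝔭.asIdeal := by
  obtain ⟨t, ht⟩ := 𝒜.exists_finset_affineOpens_cover
  exact ⟨t, ht, fun s _ => ⟨h.isNoetherianRing_of_isAffineOpen s.1 s.2.2,
    fun 𝔭 => h.isLogRegularAt_of_isAffineOpen s.1 s.2.2 𝔭⟩⟩

end EtaleLogAtlas

end Literature.AlgebraicGeometry.Resolution

end
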